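import Summits.NavierStokesRegularity.NavierStokesRegularity.Theorems.FilamentSkeletonRssCoreLinearInvertibilityOddSymmetrizerBoundsPotential
import Summits.NavierStokesRegularity.NavierStokesRegularity.Theorems.FilamentSkeletonRssCoreLinearInvertibilityOddSymmetrizerBoundsWeight
import Summits.NavierStokesRegularity.NavierStokesRegularity.Theorems.FilamentSkeletonRssCoreLinearInvertibilityClassClosureCalc
import Summits.NavierStokesRegularity.NavierStokesRegularity.Theorems.FilamentSkeletonRssCoreLinearInvertibilityParityTools

/-!
# Crux `CoreLinearInvertibility` (stmt-NavierStokesRegularity-17973), line `Sketch`: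
# tools for stub `stub_oddSymmetrizerBounds` — the symmetrizer `u = Φ(|x|) ψ`: class, parity, identity

Helper file (theorems only; lands `--supports stmt-NavierStokesRegularity-17973`, ends with the
registered sub-stub `stub_oddSymmetrizerBoundsToolsC`) for the stub `stub_oddSymmetrizerBounds` of
the skeleton `Cruxes/CoreLinearInvertibility/Lines/Sketch.lean`.  For an odd `C²_c` planar
vorticity `w`, its logarithmic potential `ψ = N ∗ w` and Maekawa's symmetrizer `u = Φ(|x|) ψ`
(`Φ = kerWeight = G/(2Ω)`):

* `u ∈ C²` is odd and `w`, `u`, `w + u` are of second-order Gaussian class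
  `|·|, ‖D·‖, ‖D²·‖ ≤ C (1 + |x|)^N e^{−|x|²/4}` (tools A: `|ψ|, ‖Dψ‖, ‖D²ψ‖ ≤ C(1+|x|)`; tools B:
  the class of `Φ(|·|)`; Leibniz at second order);
* hence `|L_λ f| ≤ 3C(1+|x|)^{N+1} e^{−|x|²/4}` and `|L_λ f − R v^G·∇f| ≤ (3 + |R|) C (1+|x|)^{N+1} e^{−|x|²/4}`
  for such `f`, all the weighted squares `G_λ⁻¹(·)²` are integrable, and `L_λ u`, `H(w+u)` are
  continuous;
* **the pointwise identity** `v^G · ∇u = (K ∗ w) · ∇G` (`∇Φ(|·|) ∥ x ⊥ v^G`, `ΦΩ = G/2`,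
  `K ∗ w = (∇ψ)^⊥`, `∇G = −(x/2)G`), whence `T_{λ,R} w = H_{λ,R}(w + u) − L_λ u` with the LOCAL
  operator `H_{λ,R} = L_λ − R v^G·∇`.

References: Y. Maekawa, J. Math. Fluid Mech. 13 (2011) §2; Th. Gallay, Y. Maekawa,
arXiv:1610.08384, Lemma 2.7; folklore.
-/

set_option linter.dupNamespace false

noncomputable section

namespace Summit.NavierStokesRegularity.NavierStokesRegularity.Theorems

open MeasureTheory Filter Topology Set Function Metric
open Literature.Analysis.FluidPDE
open Summit.AnomalousDissipation.AnomalousDissipation.Theorems.MarginalStabilityChainStretchedVortexRows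
open scoped InnerProductSpace Laplacian ContDiff

/-! ### Second-order Gaussian class: closure properties and consequences -/

/-- A `C²` compactly supported function is of second-order Gaussian class. [folklore] -/
theorem oddSym_class_of_hasCompactSupport {w : EuclideanSpace ℝ (Fin 2) → ℝ} (hw : ContDiff ℝ 2 w)
    (hwc : HasCompactSupport w) :
    ∃ (C : ℝ) (N : ℕ), 0 ≤ C ∧ ∀ x : EuclideanSpace ℝ (Fin 2),
      |w x| ≤ C * (1 + ‖x‖) ^ N * Real.exp (-(‖x‖ ^ 2 / 4)) ∧
      ‖fderiv ℝ w x‖ ≤ C * (1 + ‖x‖) ^ N * Real.exp (-(‖x‖ ^ 2 / 4)) ∧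
      ‖fderiv ℝ (fderiv ℝ w) x‖ ≤ C * (1 + ‖x‖) ^ N * Real.exp (-(‖x‖ ^ 2 / 4)) := by
  obtain ⟨B₀, hB₀, h₀⟩ := oddSym_exists_gauss_bound hw.continuous hwc (1 / 4)
  obtain ⟨B₁, hB₁, h₁⟩ := oddSym_exists_gauss_bound (hw.continuous_fderiv two_ne_zero)
    (hwc.fderiv (𝕜 := ℝ)) (1 / 4)
  obtain ⟨B₂, hB₂, h₂⟩ := oddSym_exists_gauss_bound
    ((hw.fderiv_right (m := 1) le_rfl).continuous_fderiv one_ne_zero)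
    ((hwc.fderiv (𝕜 := ℝ)).fderiv (𝕜 := ℝ)) (1 / 4)
  refine ⟨B₀ + B₁ + B₂, 0, by positivity, fun x => ?_⟩
  have he : Real.exp (-(1 / 4) * ‖x‖ ^ 2) = Real.exp (-(‖x‖ ^ 2 / 4)) := by congr 1; ring
  have he0 : 0 ≤ Real.exp (-(‖x‖ ^ 2 / 4)) := (Real.exp_pos _).le
  rw [pow_zero, mul_one]
  refine ⟨?_, ?_, ?_⟩
  · have := h₀ x; rw [Real.norm_eq_abs, he] at this; nlinarith
  · have := h₁ x; rw [he] at this; nlinarith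
  · have := h₂ x; rw [he] at this; nlinarith

/-- The second-order Gaussian class is closed under sums. [folklore] -/
theorem oddSym_class_add {f g : EuclideanSpace ℝ (Fin 2) → ℝ} (hf : ContDiff ℝ 2 f) (hg : ContDiff ℝ 2 g)
    {C D : ℝ} {N M : ℕ} (hC : 0 ≤ C) (hD : 0 ≤ D)
    (hfC : ∀ x : EuclideanSpace ℝ (Fin 2),
      |f x| ≤ C * (1 + ‖x‖) ^ N * Real.exp (-(‖x‖ ^ 2 / 4)) ∧
      ‖fderiv ℝ f x‖ ≤ C * (1 + ‖x‖) ^ N * Real.exp (-(‖x‖ ^ 2 / 4)) ∧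
      ‖fderiv ℝ (fderiv ℝ f) x‖ ≤ C * (1 + ‖x‖) ^ N * Real.exp (-(‖x‖ ^ 2 / 4)))
    (hgD : ∀ x : EuclideanSpace ℝ (Fin 2),
      |g x| ≤ D * (1 + ‖x‖) ^ M * Real.exp (-(‖x‖ ^ 2 / 4)) ∧
      ‖fderiv ℝ g x‖ ≤ D * (1 + ‖x‖) ^ M * Real.exp (-(‖x‖ ^ 2 / 4)) ∧
      ‖fderiv ℝ (fderiv ℝ g) x‖ ≤ D * (1 + ‖x‖) ^ M * Real.exp (-(‖x‖ ^ 2 / 4))) :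
    ∀ x : EuclideanSpace ℝ (Fin 2),
      |f x + g x| ≤ (C + D) * (1 + ‖x‖) ^ (N + M) * Real.exp (-(‖x‖ ^ 2 / 4)) ∧
      ‖fderiv ℝ (fun y => f y + g y) x‖ ≤ (C + D) * (1 + ‖x‖) ^ (N + M) * Real.exp (-(‖x‖ ^ 2 / 4)) ∧
      ‖fderiv ℝ (fderiv ℝ (fun y => f y + g y)) x‖ ≤
        (C + D) * (1 + ‖x‖) ^ (N + M) * Real.exp (-(‖x‖ ^ 2 / 4)) := by
  intro x
  obtain ⟨f0, f1, f2⟩ := hfC x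
  obtain ⟨g0, g1, g2⟩ := hgD x
  have hfd : Differentiable ℝ f := hf.differentiable two_ne_zero
  have hgd : Differentiable ℝ g := hg.differentiable two_ne_zero
  have hDsum : fderiv ℝ (fun y => f y + g y) = fun x => fderiv ℝ f x + fderiv ℝ g x :=
    funext fun x => fderiv_fun_add (hfd x) (hgd x)
  have hdf' : DifferentiableAt ℝ (fderiv ℝ f) x :=
    ((hf.fderiv_right (m := 1) le_rfl).differentiable one_ne_zero) x
  have hdg' : DifferentiableAt ℝ (fderiv ℝ g) x :=
    ((hg.fderiv_right (m := 1) le_rfl).differentiable one_ne_zero) x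
  set E : ℝ := Real.exp (-(‖x‖ ^ 2 / 4)) with hE
  have hE0 : 0 ≤ E := (Real.exp_pos _).le
  have hr : (1 : ℝ) ≤ 1 + ‖x‖ := by linarith [norm_nonneg x]
  have hpN : (1 + ‖x‖) ^ N ≤ (1 + ‖x‖) ^ (N + M) := pow_le_pow_right₀ hr (Nat.le_add_right N M)
  have hpM : (1 + ‖x‖) ^ M ≤ (1 + ‖x‖) ^ (N + M) := pow_le_pow_right₀ hr (Nat.le_add_left M N)
  have kC : C * (1 + ‖x‖) ^ N * E ≤ C * (1 + ‖x‖) ^ (N + M) * E := by gcongr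
  have kD : D * (1 + ‖x‖) ^ M * E ≤ D * (1 + ‖x‖) ^ (N + M) * E := by gcongr
  refine ⟨?_, ?_, ?_⟩
  · calc |f x + g x| ≤ |f x| + |g x| := abs_add_le _ _
      _ ≤ _ := by linarith
  · rw [hDsum]
    calc ‖fderiv ℝ f x + fderiv ℝ g x‖ ≤ ‖fderiv ℝ f x‖ + ‖fderiv ℝ g x‖ := norm_add_le _ _
      _ ≤ _ := by linarith
  · rw [hDsum, fderiv_fun_add hdf' hdg']
    calc ‖fderiv ℝ (fderiv ℝ f) x + fderiv ℝ (fderiv ℝ g) x‖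
        ≤ ‖fderiv ℝ (fderiv ℝ f) x‖ + ‖fderiv ℝ (fderiv ℝ g) x‖ := ContinuousLinearMap.opNorm_add_le _ _
      _ ≤ _ := by linarith

/-- **Gaussian class of `L_λ f` and of `L_λ f − R v^G·∇f`** for `f` of second-order Gaussian class and
`|λ| ≤ 1`: `|L_λ f| ≤ 3C(1+|x|)^{N+1}e^{−|x|²/4}`,
`|L_λ f − R ⟪v^G, ∇f⟫| ≤ (3 + |R|) C (1+|x|)^{N+1} e^{−|x|²/4}` (`‖v^G‖ ≤ 1 + |x|`). [folklore] -/
theorem oddSym_class_coreLocal {f : EuclideanSpace ℝ (Fin 2) → ℝ} {C lam : ℝ} {N : ℕ} (hlam : |lam| ≤ 1)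
    (hC : 0 ≤ C)
    (hfC : ∀ x : EuclideanSpace ℝ (Fin 2),
      |f x| ≤ C * (1 + ‖x‖) ^ N * Real.exp (-(‖x‖ ^ 2 / 4)) ∧
      ‖fderiv ℝ f x‖ ≤ C * (1 + ‖x‖) ^ N * Real.exp (-(‖x‖ ^ 2 / 4)) ∧
      ‖fderiv ℝ (fderiv ℝ f) x‖ ≤ C * (1 + ‖x‖) ^ N * Real.exp (-(‖x‖ ^ 2 / 4)))
    (R : ℝ) (x : EuclideanSpace ℝ (Fin 2)) :
    |strainedVorticityOperator lam f x| ≤ 3 * C * (1 + ‖x‖) ^ (N + 1) * Real.exp (-(‖x‖ ^ 2 / 4)) ∧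
    |strainedVorticityOperator lam f x - R * ⟪gaussVortexVelocity x, gradient f x⟫_ℝ| ≤
      (3 + |R|) * C * (1 + ‖x‖) ^ (N + 1) * Real.exp (-(‖x‖ ^ 2 / 4)) := by
  obtain ⟨f0, f1, f2⟩ := hfC x
  have hL := oddSym_abs_strainedVorticityOperator_le hlam f0 f1 f2
  have hL' : |strainedVorticityOperator lam f x| ≤ 3 * C * (1 + ‖x‖) ^ (N + 1) * Real.exp (-(‖x‖ ^ 2 / 4)) := by
    rw [pow_succ]; linarith
  refine ⟨hL', ?_⟩
  have hv : ‖gaussVortexVelocity x‖ ≤ 1 + ‖x‖ := by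
    have := norm_gaussVortexVelocity_le x; rwa [one_mul, pow_one] at this
  have hin : |⟪gaussVortexVelocity x, gradient f x⟫_ℝ| ≤ (1 + ‖x‖) * (C * (1 + ‖x‖) ^ N * Real.exp (-(‖x‖ ^ 2 / 4))) := by
    refine (abs_real_inner_le_norm _ _).trans (mul_le_mul hv ?_ (norm_nonneg _) (by positivity))
    rw [gradient, LinearIsometryEquiv.norm_map]; exact f1
  have hE0 : 0 ≤ (1 + ‖x‖) * (C * (1 + ‖x‖) ^ N * Real.exp (-(‖x‖ ^ 2 / 4))) := by positivity
  calc |strainedVorticityOperator lam f x - R * ⟪gaussVortexVelocity x, gradient f x⟫_ℝ|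
      ≤ |strainedVorticityOperator lam f x| + |R| * |⟪gaussVortexVelocity x, gradient f x⟫_ℝ| := by
        rw [← abs_mul]; exact abs_sub _ _
    _ ≤ 3 * C * (1 + ‖x‖) ^ (N + 1) * Real.exp (-(‖x‖ ^ 2 / 4)) +
        |R| * ((1 + ‖x‖) * (C * (1 + ‖x‖) ^ N * Real.exp (-(‖x‖ ^ 2 / 4)))) :=
        add_le_add hL' (mul_le_mul_of_nonneg_left hin (abs_nonneg R))
    _ = (3 + |R|) * C * (1 + ‖x‖) ^ (N + 1) * Real.exp (-(‖x‖ ^ 2 / 4)) := by rw [pow_succ]; ring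

/-! ### The symmetrizer `u = Φ(|x|) ψ` -/

section Symmetrizer

variable {w ψ u : EuclideanSpace ℝ (Fin 2) → ℝ} (hw : ContDiff ℝ 2 w) (hwc : HasCompactSupport w)
  (hψ : ∀ x, ψ x = ∫ y, (2 * Real.pi)⁻¹ * Real.log ‖x - y‖ * w y)
  (hu : ∀ x, u x = kerWeight ‖x‖ * ψ x)

include hu in
/-- `u = Φ(|·|) · ψ` as functions. [folklore] -/
theorem oddSym_u_eq : u = fun x => (fun y : EuclideanSpace ℝ (Fin 2) => kerWeight ‖y‖) x * ψ x := funext hu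

include hw hwc hψ hu in
/-- **`u ∈ C²`.** [folklore] -/
theorem oddSym_u_contDiff : ContDiff ℝ 2 u := by
  rw [oddSym_u_eq hu]
  exact oddSym_theta_contDiff.mul (oddSym_psi_contDiff_two hw hwc hψ).1

include hψ hu in
/-- **`u` is odd** when `w` is odd (`Φ(|·|)` is even, `ψ` is odd). [folklore] -/
theorem oddSym_u_odd (hodd : ∀ x, w (-x) = -w x) (x : EuclideanSpace ℝ (Fin 2)) : u (-x) = -u x := by
  rw [hu, hu, norm_neg, oddSym_psi_odd hψ hodd, mul_neg]

include hw hwc hψ hu in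
/-- **`u` is of second-order Gaussian class.** [folklore] -/
theorem oddSym_u_class : ∃ (C : ℝ) (N : ℕ), 0 ≤ C ∧ ∀ x : EuclideanSpace ℝ (Fin 2),
    |u x| ≤ C * (1 + ‖x‖) ^ N * Real.exp (-(‖x‖ ^ 2 / 4)) ∧
    ‖fderiv ℝ u x‖ ≤ C * (1 + ‖x‖) ^ N * Real.exp (-(‖x‖ ^ 2 / 4)) ∧
    ‖fderiv ℝ (fderiv ℝ u) x‖ ≤ C * (1 + ‖x‖) ^ N * Real.exp (-(‖x‖ ^ 2 / 4)) := by
  obtain ⟨Cθ, N, hCθ, hθ⟩ := oddSym_theta_bounds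
  obtain ⟨Cψ, hCψ, hψb⟩ := oddSym_psi_bounds hw hwc hψ
  have h := oddSym_mul_bounds (a := fun x => Cθ * (1 + ‖x‖) ^ N * Real.exp (-(‖x‖ ^ 2 / 4)))
    (b := fun x => Cψ * (1 + ‖x‖)) oddSym_theta_contDiff (oddSym_psi_contDiff_two hw hwc hψ).1 hθ hψb
  rw [oddSym_u_eq hu]
  refine ⟨4 * (Cθ * Cψ), N + 1, by positivity, fun x => ?_⟩
  have key : 4 * (Cθ * (1 + ‖x‖) ^ N * Real.exp (-(‖x‖ ^ 2 / 4)) * (Cψ * (1 + ‖x‖))) =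
      4 * (Cθ * Cψ) * (1 + ‖x‖) ^ (N + 1) * Real.exp (-(‖x‖ ^ 2 / 4)) := by rw [pow_succ]; ring
  rw [← key]
  exact h x

include hw hwc hψ hu in
/-- **`w + u` is of second-order Gaussian class** (the class hypothesis of `stub_oddAttenuation`). [folklore] -/
theorem oddSym_add_class : ∃ (C : ℝ) (N : ℕ), 0 ≤ C ∧ ∀ x : EuclideanSpace ℝ (Fin 2),
    |w x + u x| ≤ C * (1 + ‖x‖) ^ N * Real.exp (-(‖x‖ ^ 2 / 4)) ∧
    ‖fderiv ℝ (fun y => w y + u y) x‖ ≤ C * (1 + ‖x‖) ^ N * Real.exp (-(‖x‖ ^ 2 / 4)) ∧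
    ‖fderiv ℝ (fderiv ℝ (fun y => w y + u y)) x‖ ≤ C * (1 + ‖x‖) ^ N * Real.exp (-(‖x‖ ^ 2 / 4)) := by
  obtain ⟨C, N, hC, hwC⟩ := oddSym_class_of_hasCompactSupport hw hwc
  obtain ⟨D, M, hD, huD⟩ := oddSym_u_class hw hwc hψ hu
  exact ⟨C + D, N + M, by positivity, oddSym_class_add hw (oddSym_u_contDiff hw hwc hψ hu) hC hD hwC huD⟩

/-! ### The pointwise identity `v^G · ∇u = (K ∗ w) · ∇G` -/

include hw hwc hψ hu in
/-- **`⟪v^G(x), ∇u(x)⟫ = ⟪(K ∗ w)(x), ∇G(x)⟫`**: `∇u = ψ∇Φ + Φ∇ψ` with `∇Φ(|·|)(x) ∥ x ⊥ v^G(x)`,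
`v^G = Ω x^⊥`, `ΦΩ = G/2`; and `∇G = −(G/2)x`, `K ∗ w = (∇ψ)^⊥`, `⟪x, a^⊥⟫ = −⟪x^⊥, a⟫`. [folklore] -/
theorem oddSym_inner_velocity_gradient_u (x : EuclideanSpace ℝ (Fin 2)) :
    ⟪gaussVortexVelocity x, gradient u x⟫_ℝ = ⟪biotSavart2D w x, gradient gaussVortexProfile x⟫_ℝ := by
  have hψC2 := (oddSym_psi_contDiff_two hw hwc hψ).1
  have hθd : DifferentiableAt ℝ (fun y : EuclideanSpace ℝ (Fin 2) => kerWeight ‖y‖) x :=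
    (oddSym_theta_contDiff (n := 1)).differentiable one_ne_zero x
  have hψd : DifferentiableAt ℝ ψ x := hψC2.differentiable two_ne_zero x
  -- left-hand side
  have hperp : ⟪x, gaussVortexVelocity x⟫_ℝ = 0 := by
    rw [gaussVortexVelocity, inner_smul_right, inner_self_perp, mul_zero]
  have hL : ⟪gaussVortexVelocity x, gradient u x⟫_ℝ = gaussVortexProfile x / 2 * fderiv ℝ ψ x (perp x) := by
    rw [real_inner_gradient_right, oddSym_u_eq hu, fderiv_fun_mul hθd hψd]
    simp only [_root_.add_apply, FunLike.coe_smul, Pi.smul_apply, smul_eq_mul]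
    rw [oddSym_fderiv_theta_eq_zero hperp, mul_zero, add_zero, gaussVortexVelocity, map_smul, smul_eq_mul,
      ← mul_assoc, oddSym_theta_mul_omega]
  -- right-hand side
  have hR : ⟪biotSavart2D w x, gradient gaussVortexProfile x⟫_ℝ = gaussVortexProfile x / 2 * fderiv ℝ ψ x (perp x) := by
    rw [real_inner_gradient_right, fderiv_gaussVortexProfile_apply, oddSym_biotSavart2D_eq_perp_gradient hw hwc hψ x,
      inner_perp_right, real_inner_gradient_right]
    ring
  rw [hL, hR]

include hw hwc hψ hu in
/-- **The exact identity `T_{λ,R} w = H_{λ,R}(w + u) − L_λ u`** with the LOCAL operator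
`H_{λ,R} f = L_λ f − R v^G·∇f` (linearity of `L_λ` and `∇` on `C²`, and the pointwise identity). [folklore] -/
theorem oddSym_identity (lam R : ℝ) (x : EuclideanSpace ℝ (Fin 2)) :
    strainedVorticityOperator lam w x -
        R * (⟪gaussVortexVelocity x, gradient w x⟫_ℝ + ⟪biotSavart2D w x, gradient gaussVortexProfile x⟫_ℝ) =
      (strainedVorticityOperator lam (fun y => w y + u y) x -
          R * ⟪gaussVortexVelocity x, gradient (fun y => w y + u y) x⟫_ℝ) -
        strainedVorticityOperator lam u x := by
  have huC2 := oddSym_u_contDiff hw hwc hψ hu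
  have hΔ : Δ (fun y => w y + u y) x = Δ w x + Δ u x :=
    ContDiffAt.laplacian_add (f₁ := w) (f₂ := u) hw.contDiffAt huC2.contDiffAt
  have hD : fderiv ℝ (fun y => w y + u y) x = fderiv ℝ w x + fderiv ℝ u x :=
    fderiv_fun_add (hw.differentiable two_ne_zero x) (huC2.differentiable two_ne_zero x)
  have hL : strainedVorticityOperator lam (fun y => w y + u y) x =
      strainedVorticityOperator lam w x + strainedVorticityOperator lam u x := by
    simp only [strainedVorticityOperator, hΔ, hD, _root_.add_apply]
    ring
  have hgrad : gradient (fun y => w y + u y) x = gradient w x + gradient u x := by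
    simp only [gradient, hD, map_add]
  rw [hL, hgrad, inner_add_right, oddSym_inner_velocity_gradient_u hw hwc hψ hu x]
  ring

/-! ### Integrability and continuity clauses -/

include hw hwc hψ hu in
/-- The weighted squares of `w`, `w + u`, `L_λ u` and `H(w+u)` are integrable and `L_λ u`, `H(w+u)`
are continuous (`λ ∈ (0,1)`). [folklore] -/
theorem oddSym_integrable_continuous {lam : ℝ} (hlam : lam ∈ Set.Ioo (0 : ℝ) 1) :
    Integrable (fun x => (gaussWeightLam lam x)⁻¹ * w x ^ 2) ∧
    Integrable (fun x => (gaussWeightLam lam x)⁻¹ * (w x + u x) ^ 2) ∧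
    Integrable (fun x => (gaussWeightLam lam x)⁻¹ * (strainedVorticityOperator lam u x) ^ 2) ∧
    (∀ R : ℝ, Integrable (fun x => (gaussWeightLam lam x)⁻¹ *
      (strainedVorticityOperator lam (fun y => w y + u y) x -
        R * ⟪gaussVortexVelocity x, gradient (fun y => w y + u y) x⟫_ℝ) ^ 2)) ∧
    Continuous (fun x => strainedVorticityOperator lam u x) ∧
    (∀ R : ℝ, Continuous (fun x => strainedVorticityOperator lam (fun y => w y + u y) x -
        R * ⟪gaussVortexVelocity x, gradient (fun y => w y + u y) x⟫_ℝ)) := by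
  have hlam' : lam ∈ Set.Ico (0 : ℝ) 1 := ⟨hlam.1.le, hlam.2⟩
  have hl : |lam| ≤ 1 := by rw [abs_le]; constructor <;> linarith [hlam.1, hlam.2]
  have huC2 := oddSym_u_contDiff hw hwc hψ hu
  have hsC2 : ContDiff ℝ 2 (fun y => w y + u y) := hw.add huC2
  obtain ⟨Cw, Nw, hCw, hwC⟩ := oddSym_class_of_hasCompactSupport hw hwc
  obtain ⟨Cs, Ns, hCs, hsC⟩ := oddSym_add_class hw hwc hψ hu
  obtain ⟨Cu, Nu, hCu, huC⟩ := oddSym_u_class hw hwc hψ hu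
  have hcontL : Continuous (fun x => strainedVorticityOperator lam u x) :=
    continuous_strainedVorticityOperator huC2 lam
  have hcontH : ∀ R : ℝ, Continuous (fun x => strainedVorticityOperator lam (fun y => w y + u y) x -
      R * ⟪gaussVortexVelocity x, gradient (fun y => w y + u y) x⟫_ℝ) := fun R =>
    parity_continuous_localPart lam R hsC2
  refine ⟨?_, ?_, ?_, fun R => ?_, hcontL, hcontH⟩
  · exact oddSym_integrable_inv_gaussWeightLam_mul_sq hlam' hw.continuous.aestronglyMeasurable
      fun x => (hwC x).1
  · exact oddSym_integrable_inv_gaussWeightLam_mul_sq hlam' hsC2.continuous.aestronglyMeasurable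
      fun x => (hsC x).1
  · exact oddSym_integrable_inv_gaussWeightLam_mul_sq hlam' hcontL.aestronglyMeasurable
      fun x => (oddSym_class_coreLocal hl hCu huC 0 x).1
  · exact oddSym_integrable_inv_gaussWeightLam_mul_sq hlam' (hcontH R).aestronglyMeasurable
      fun x => (oddSym_class_coreLocal hl hCs hsC R x).2

end Symmetrizer

/-! ### The registered sub-stub -/

/-- **Sub-stub `stub_oddSymmetrizerBoundsToolsC` of crux stmt-NavierStokesRegularity-17973, line
`Sketch`** (tools for `stub_oddSymmetrizerBounds`): for a `C²_c` vorticity `w`, `ψ = N ∗ w` and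
`u = Φ(|x|)ψ`: `u ∈ C²`; `u` is odd when `w` is; `w + u` is of second-order Gaussian class; the exact
identity `T_{λ,R} w = H_{λ,R}(w+u) − L_λ u`; and, for `λ ∈ (0,1)`, the integrability of the weighted
squares of `w`, `w + u`, `L_λ u`, `H(w+u)` and the continuity of `L_λ u`, `H(w+u)`. [folklore] -/
theorem stub_oddSymmetrizerBoundsToolsC :
    ∀ (w ψ u : EuclideanSpace ℝ (Fin 2) → ℝ), ContDiff ℝ 2 w → HasCompactSupport w →
    (∀ x, ψ x = ∫ y, (2 * Real.pi)⁻¹ * Real.log ‖x - y‖ * w y) →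
    (∀ x, u x = kerWeight ‖x‖ * ψ x) →
    ContDiff ℝ 2 u ∧ ((∀ x, w (-x) = -w x) → ∀ x, u (-x) = -u x) ∧
    (∃ (C' : ℝ) (N : ℕ), 0 ≤ C' ∧ ∀ x : EuclideanSpace ℝ (Fin 2),
      |w x + u x| ≤ C' * (1 + ‖x‖) ^ N * Real.exp (-(‖x‖ ^ 2 / 4)) ∧
      ‖fderiv ℝ (fun y => w y + u y) x‖ ≤ C' * (1 + ‖x‖) ^ N * Real.exp (-(‖x‖ ^ 2 / 4)) ∧
      ‖fderiv ℝ (fderiv ℝ (fun y => w y + u y)) x‖ ≤ C' * (1 + ‖x‖) ^ N * Real.exp (-(‖x‖ ^ 2 / 4))) ∧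
    (∀ (lam R : ℝ) (x : EuclideanSpace ℝ (Fin 2)),
      strainedVorticityOperator lam w x -
          R * (⟪gaussVortexVelocity x, gradient w x⟫_ℝ +
            ⟪biotSavart2D w x, gradient gaussVortexProfile x⟫_ℝ) =
        (strainedVorticityOperator lam (fun y => w y + u y) x -
            R * ⟪gaussVortexVelocity x, gradient (fun y => w y + u y) x⟫_ℝ) -
          strainedVorticityOperator lam u x) ∧
    (∀ lam ∈ Set.Ioo (0 : ℝ) 1,
      Integrable (fun x => (gaussWeightLam lam x)⁻¹ * w x ^ 2) ∧
      Integrable (fun x => (gaussWeightLam lam x)⁻¹ * (w x + u x) ^ 2) ∧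
      Integrable (fun x => (gaussWeightLam lam x)⁻¹ * (strainedVorticityOperator lam u x) ^ 2) ∧
      (∀ R : ℝ, Integrable (fun x => (gaussWeightLam lam x)⁻¹ *
        (strainedVorticityOperator lam (fun y => w y + u y) x -
          R * ⟪gaussVortexVelocity x, gradient (fun y => w y + u y) x⟫_ℝ) ^ 2)) ∧
      Continuous (fun x => strainedVorticityOperator lam u x) ∧
      (∀ R : ℝ, Continuous (fun x => strainedVorticityOperator lam (fun y => w y + u y) x -
          R * ⟪gaussVortexVelocity x, gradient (fun y => w y + u y) x⟫_ℝ))) :=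
  fun _ _ _ hw hwc hψ hu => ⟨oddSym_u_contDiff hw hwc hψ hu, fun hodd => oddSym_u_odd hψ hu hodd,
    oddSym_add_class hw hwc hψ hu, oddSym_identity hw hwc hψ hu,
    fun _ hlam => oddSym_integrable_continuous hw hwc hψ hu hlam⟩

end Summit.NavierStokesRegularity.NavierStokesRegularity.Theorems
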